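import Mathlib

/-!
# SoloBlindLandingFarField — the live-side far field of the canonical landing member

Solo-blind programme on `AnomalousDissipation`, paper §24.67(1) (the O(L) landing inner problem),
CLAIMS SB-C681/SB-C684.  In the inner variables of the quartic (neutral-leaf) landing, the squared
amplitude of the canonical jump-free member has the live-side far field

  `Q(ξ) = ξ⁴/24 + 2 (ξ log|ξ| − ξ) + c₀`     (ξ → −∞),

and the quantity that drives the next-order (O(L)) problem is `m := α₀″/α₀ = (2 Q Q″ − Q′²)/(4 Q²)`.
We certify, with `ℓ` standing for `log |ξ|`:

* `hasDerivAt_landQ`, `hasDerivAt_landQ'` : `Q′ = ξ³/6 + 2 log|ξ|`, `Q″ = ξ²/2 + 2/ξ` for `ξ ≠ 0`;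
* `landing_twoQQ''_sub_sq` : the closed form
  `2QQ″ − Q′² = ξ⁶/72 + (4/3)ξ³ℓ − (11/6)ξ³ + c₀ξ² − 4ℓ² + 8ℓ − 8 + 4c₀/ξ`;
* `landing_m_truncation` : the exact identity
  `(2QQ″ − Q′²)·ξ⁶ = 4Q²·(2ξ⁴ − 72ξ + 48c₀) + R(ξ, ℓ, c₀)` with an explicit remainder `R` all of whose
  monomials have ξ-degree ≤ 6, i.e. `m = 2/ξ² − 72/ξ⁵ + 48c₀/ξ⁶ + R/(4Q²ξ⁶)` and the logarithms cancel
  in `m` through order `ξ⁻⁶` (the remainder is `O(log²|ξ| / ξ⁸)` since `4Q² ~ ξ⁸/144`);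
* `landing_m_eq` : the same identity solved for `m` when `Q ≠ 0`, `ξ ≠ 0`.

These are the expansions used for the far-field rows of the linear O(L) landing solve (24.67(2)).
Everything is elementary calculus plus `ring`; no analysis of the inner problem itself is claimed.
-/

namespace Summit.AnomalousDissipation.AnomalousDissipation.Theorems

/-- Far-field squared amplitude of the canonical landing member, `Q(ξ) = ξ⁴/24 + 2(ξ log|ξ| − ξ) + c₀`. -/
noncomputable def landQ (c₀ ξ : ℝ) : ℝ := ξ ^ 4 / 24 + 2 * (ξ * Real.log |ξ| - ξ) + c₀

/-- Its first derivative off the origin, `Q′(ξ) = ξ³/6 + 2 log|ξ|`. -/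
noncomputable def landQ' (ξ : ℝ) : ℝ := ξ ^ 3 / 6 + 2 * Real.log |ξ|

/-- Its second derivative off the origin, `Q″(ξ) = ξ²/2 + 2/ξ`. -/
noncomputable def landQ'' (ξ : ℝ) : ℝ := ξ ^ 2 / 2 + 2 / ξ

/-- The explicit remainder of the truncation `m = 2/ξ² − 72/ξ⁵ + 48c₀/ξ⁶ + R/(4Q²ξ⁶)`;
every monomial has ξ-degree at most 6 (and `ℓ = log|ξ|`-degree at most 2). -/
def landR (c₀ ξ ℓ : ℝ) : ℝ :=
  (-36) * ξ ^ 6 * ℓ ^ 2 + 120 * ξ ^ 6 * ℓ + (-88) * ξ ^ 6 + (-64) * ξ ^ 5 * ℓ * c₀ + 92 * ξ ^ 5 * c₀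
  + (-24) * ξ ^ 4 * c₀ ^ 2 + 1152 * ξ ^ 3 * ℓ ^ 2 + (-2304) * ξ ^ 3 * ℓ + 1152 * ξ ^ 3
  + (-768) * ξ ^ 2 * ℓ ^ 2 * c₀ + 2688 * ξ ^ 2 * ℓ * c₀ + (-1920) * ξ ^ 2 * c₀
  + (-768) * ξ * ℓ * c₀ ^ 2 + 1056 * ξ * c₀ ^ 2 + (-192) * c₀ ^ 3

/-- `d/dξ Q = Q′` for `ξ ≠ 0` (valid on both sides of the origin: `Real.log |ξ| = Real.log ξ`). -/
theorem hasDerivAt_landQ (c₀ : ℝ) {ξ : ℝ} (hξ : ξ ≠ 0) :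
    HasDerivAt (landQ c₀) (landQ' ξ) ξ := by
  have hlog : HasDerivAt (fun x : ℝ => Real.log |x|) ξ⁻¹ ξ := by
    simp only [Real.log_abs]; exact Real.hasDerivAt_log hξ
  have h1 : HasDerivAt (fun x : ℝ => x * Real.log |x|) (1 * Real.log |ξ| + ξ * ξ⁻¹) ξ :=
    (hasDerivAt_id' ξ).mul hlog
  have h2 : HasDerivAt (fun x : ℝ => x ^ 4 / 24) (((4 : ℕ) : ℝ) * ξ ^ (4 - 1) / 24) ξ :=
    (hasDerivAt_pow 4 ξ).div_const 24
  have h3 := (h2.add ((h1.sub (hasDerivAt_id' ξ)).const_mul 2)).add (hasDerivAt_const ξ c₀)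
  have e : ((4 : ℕ) : ℝ) * ξ ^ (4 - 1) / 24 + 2 * (1 * Real.log |ξ| + ξ * ξ⁻¹ - 1) + 0 = landQ' ξ := by
    simp only [landQ']
    field_simp
    ring
  rw [← e]
  exact h3

/-- `d/dξ Q′ = Q″` for `ξ ≠ 0`. -/
theorem hasDerivAt_landQ' {ξ : ℝ} (hξ : ξ ≠ 0) :
    HasDerivAt landQ' (landQ'' ξ) ξ := by
  have hlog : HasDerivAt (fun x : ℝ => Real.log |x|) ξ⁻¹ ξ := by
    simp only [Real.log_abs]; exact Real.hasDerivAt_log hξ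
  have h2 : HasDerivAt (fun x : ℝ => x ^ 3 / 6) (((3 : ℕ) : ℝ) * ξ ^ (3 - 1) / 6) ξ :=
    (hasDerivAt_pow 3 ξ).div_const 6
  have h3 := h2.add (hlog.const_mul 2)
  have e : ((3 : ℕ) : ℝ) * ξ ^ (3 - 1) / 6 + 2 * ξ⁻¹ = landQ'' ξ := by
    simp only [landQ'']
    field_simp
    ring
  rw [← e]
  exact h3

/-- The closed form of `2QQ″ − Q′²` with `ℓ` a free variable in place of `log|ξ|` (pure algebra). -/
theorem landing_twoQQ''_sub_sq_poly (c₀ ξ ℓ : ℝ) (hξ : ξ ≠ 0) :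
    2 * (ξ ^ 4 / 24 + 2 * (ξ * ℓ - ξ) + c₀) * (ξ ^ 2 / 2 + 2 / ξ) - (ξ ^ 3 / 6 + 2 * ℓ) ^ 2
      = ξ ^ 6 / 72 + (4 / 3) * ξ ^ 3 * ℓ - (11 / 6) * ξ ^ 3 + c₀ * ξ ^ 2 - 4 * ℓ ^ 2 + 8 * ℓ - 8
        + 4 * c₀ / ξ := by
  field_simp
  ring

/-- The closed form of `2QQ″ − Q′²` for the landing far field itself (`ℓ = log|ξ|`). -/
theorem landing_twoQQ''_sub_sq (c₀ : ℝ) {ξ : ℝ} (hξ : ξ ≠ 0) :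
    2 * landQ c₀ ξ * landQ'' ξ - landQ' ξ ^ 2
      = ξ ^ 6 / 72 + (4 / 3) * ξ ^ 3 * Real.log |ξ| - (11 / 6) * ξ ^ 3 + c₀ * ξ ^ 2
        - 4 * Real.log |ξ| ^ 2 + 8 * Real.log |ξ| - 8 + 4 * c₀ / ξ := by
  unfold landQ landQ' landQ''
  exact landing_twoQQ''_sub_sq_poly c₀ ξ (Real.log |ξ|) hξ

/-- TRUNCATION IDENTITY (pure algebra, `ℓ` free): `(2QQ″ − Q′²)·ξ⁶ = 4Q²·(2ξ⁴ − 72ξ + 48c₀) + R`.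
Since `R` has ξ-degree ≤ 6 while `4Q²ξ⁶` has degree 14, this says
`m = (2QQ″ − Q′²)/(4Q²) = 2/ξ² − 72/ξ⁵ + 48c₀/ξ⁶ + O(ℓ²/ξ⁸)`: no `ξ⁻³`, `ξ⁻⁴` terms and no
logarithm through order `ξ⁻⁶`. -/
theorem landing_m_truncation_poly (c₀ ξ ℓ : ℝ) (hξ : ξ ≠ 0) :
    (2 * (ξ ^ 4 / 24 + 2 * (ξ * ℓ - ξ) + c₀) * (ξ ^ 2 / 2 + 2 / ξ) - (ξ ^ 3 / 6 + 2 * ℓ) ^ 2) * ξ ^ 6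
      = 4 * (ξ ^ 4 / 24 + 2 * (ξ * ℓ - ξ) + c₀) ^ 2 * (2 * ξ ^ 4 - 72 * ξ + 48 * c₀)
        + landR c₀ ξ ℓ := by
  unfold landR
  field_simp
  ring

/-- The truncation identity for the landing far field itself. -/
theorem landing_m_truncation (c₀ : ℝ) {ξ : ℝ} (hξ : ξ ≠ 0) :
    (2 * landQ c₀ ξ * landQ'' ξ - landQ' ξ ^ 2) * ξ ^ 6
      = 4 * landQ c₀ ξ ^ 2 * (2 * ξ ^ 4 - 72 * ξ + 48 * c₀) + landR c₀ ξ (Real.log |ξ|) := by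
  unfold landQ landQ' landQ''
  exact landing_m_truncation_poly c₀ ξ (Real.log |ξ|) hξ

/-- The same identity solved for `m = (2QQ″ − Q′²)/(4Q²)` where `Q ≠ 0`:
`m = 2/ξ² − 72/ξ⁵ + 48c₀/ξ⁶ + R/(4Q²ξ⁶)`. -/
theorem landing_m_eq (c₀ : ℝ) {ξ : ℝ} (hξ : ξ ≠ 0) (hQ : landQ c₀ ξ ≠ 0) :
    (2 * landQ c₀ ξ * landQ'' ξ - landQ' ξ ^ 2) / (4 * landQ c₀ ξ ^ 2)
      = 2 / ξ ^ 2 - 72 / ξ ^ 5 + 48 * c₀ / ξ ^ 6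
        + landR c₀ ξ (Real.log |ξ|) / (4 * landQ c₀ ξ ^ 2 * ξ ^ 6) := by
  have h := landing_m_truncation c₀ hξ
  have hQ2 : 4 * landQ c₀ ξ ^ 2 ≠ 0 := by positivity
  have hξ6 : ξ ^ 6 ≠ 0 := pow_ne_zero 6 hξ
  field_simp
  -- clear denominators in `h` as well and compare
  have h' := h
  field_simp at h'
  linear_combination h'

end Summit.AnomalousDissipation.AnomalousDissipation.Theorems
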